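/-
Copyright (c) 2026 the pub-hodgecm-mathlib formalisation cell (harness21).  Prover seat hodgecm-mathlib-F0P3-p02 (g17) (S3-ram fold pen), 2026-09-02.
-/
import Literature.NumberTheory.Rogawski1990.LocalTransferAtOneTameRamifiedRows
import HarnessLib

/-!
# The join of the three population rows at a tame-ramified place, hypothesis-form (Rogawski 1990 §4.9)

HONEST LABEL: HC_CM is proved only modulo the 2 remaining named inputs (hLiu418 24832, h413 24833) until rung 0 closes; this is Literature seeding for the
«S3-ram» road (tame-ramified twin of the S3-tree contract), cell `pub/hodgecm-mathlib`, crux H413; fold pen F0P3-p02 (g17), LEAD F0P3a-plan (g13) word T12-12 (q2) «EARLY LANDING IN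
H-FORM = GO» (the KitA «hypothesis-form heads» pattern: the two organ statements still open on the HOME fold v7.11 — the μ-free type-(2) strata count laws
(Cnt2′) × 2 — enter as HYPOTHESES whose TYPES are the tree socket-head types byte-for-byte; the type-(1) junction is ★ p848670 and consumed; nothing printed is asserted, count-neutral).
HYPOTHESIS TEXTS (c2), normalised LEN ∕ SHA16: `hCe` = ★ p847515 `typeTwo_GSideNhds_even_ram_of_literals_of_counts`'s `hCnt` — 11868 ∕ 3431d2b84ac04f90;
`hCo` = ★ p847517 `typeTwo_GSideNhds_odd_ram_of_literals_of_counts`'s `hCnt` — 11662 ∕ 40d6a8783d371dd9.  At the rows∕join level `hCe`∕`hCo` are these texts VERBATIM; at the rows-theorem ∕ waypoint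
level they are their ∀-CLOSURES over the strata binders `c₂ c' hc hc' c₁s c₁n hR4s hR4n yl hyl`, and at the contract level over `ϖ hϖ hσϖ A hA hframe g hg hgK hginv hg1` as well (the only typeable form where
those binders are not in scope; discharged by the ★ (Cnt2′) heads partially applied).

THIS MODULE (J): `leviTest_of_transferMatrix` (the certificate coefficient vector passes the Levi test — pure algebra over ★ `transferMatrix_leviRow_sum`) and `typeOneTwoRowsJoin_ram_of_counts` — ONE coefficient vector `a(c)` (the certificate row `κ·(c·M(q))`, ★ `transferMatrix_leviRow_sum` ∕ `masses_of_transferMatrix_leviRow`) serving the Levi test and both population rows; imports (R).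

## References
* [Rogawski1990] J. D. Rogawski, *Automorphic Representations of Unitary Groups in Three Variables*, Ann. of Math. Stud. 123 (1990): §4.3 (4.3.1) p. 43; §4.9 Prop. 4.9.1 (a)(b)
  p. 55, Lemma 4.9.3 p. 56, pp. 54–56; §8.1 Prop. 8.1.1 p. 112, Prop. 8.1.2 p. 114.
* [LanglandsShelstad1990Descent] R. P. Langlands, D. Shelstad, *Descent for transfer factors*, The Grothendieck Festschrift II (1990): §2.1 (2.1.2).
* [LabesseLanglands1979] J.-P. Labesse, R. P. Langlands, *L-indistinguishability for SL(2)*, Canad. J. Math. 31 (1979): §2 Lemma 2.1.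
-/

set_option autoImplicit false

noncomputable section

open NumberField IsDedekindDomain MeasureTheory Measure Topology Filter
open Literature.NumberTheory.Rogawski1990 Literature.NumberTheory.Automorphic Literature.NumberTheory.GaloisRepresentations
open Literature.NumberTheory.Automorphic.UnitaryGroup Literature.NumberTheory.Automorphic.IntegralReduction
open Literature.NumberTheory.GaloisRepresentations.IsNonarchimedeanLocalField Literature.NumberTheory.QuadraticForms
open Literature.AlgebraicGeometry.ShimuraVarieties (unitaryGroup)
open Literature.MeasureTheory.Group (descConj)
open scoped Matrix MatrixGroups Classical ValuativeRel

namespace Literature.NumberTheory.Rogawski1990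

/-! ## §1 The Levi test of the certificate row (pure algebra) -/

/-- **(J) THE LEVI TEST OF THE CERTIFICATE ROW** — pure algebra over ★ `transferMatrix_leviRow_sum`: with `κ_L := E·G∕H_m` (`E` = the Hilbert symbol `(y_λ, θ)_v`, `G = ν_G(K′)`,
`H_m = ν_H(K_H) ≠ 0`), masses `κ₀ := κ_L`, `κ₁ := 2κ_L∕(q+1)` (the JOIN pins them, ★ `masses_of_transferMatrix_leviRow`) and `a_s(c) := κ_s·Σ_j c_j·M(q)_{j,s}`:
`(Σ_s a_s(c)·yv_s)·H_m = E·G·X(c)` for `yv = ![1, (q+1)∕2]` and the (L)-ram average bracket `X(c)`. [cite: Rogawski1990, §4.9 Prop. 4.9.1 (b) p. 55, pp. 54–56] -/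
theorem leviTest_of_transferMatrix {q : ℕ} (hq : q ≠ 0) (E G Hm : ℂ) (hH : Hm ≠ 0) (cbd creg cp cm c0 : ℂ) :
    (∑ s, (![(E * G / Hm) * (cbd * (-2 / (q : ℂ)) + creg * (-2 / (q : ℂ) ^ 2) + cp * (((q : ℂ) ^ 2 + (q : ℂ) - 1) / (q : ℂ) ^ 3) + cm * (((q : ℂ) ^ 2 + (q : ℂ) - 1) / (q : ℂ) ^ 3) +
          c0 * (2 / (q : ℂ) ^ 3)),
        (2 / ((q : ℂ) + 1) * (E * G / Hm)) * (cbd * (((q : ℂ) + 1) / (q : ℂ)) + creg * (((q : ℂ) + 1) / (q : ℂ) ^ 2) + cp * (-(((q : ℂ) + 1) * (2 * (q : ℂ) - 1)) / (2 * (q : ℂ) ^ 3)) +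
          cm * (-(((q : ℂ) + 1) * (2 * (q : ℂ) - 1)) / (2 * (q : ℂ) ^ 3)) + c0 * (-1 / (q : ℂ) ^ 3))] : Fin 2 → ℂ) s * (![(1 : ℂ), ((q : ℂ) + 1) / 2] : Fin 2 → ℂ) s) * Hm =
      E * G * (cbd * (1 - (q : ℂ)⁻¹) +
          (q : ℂ)⁻¹ * (creg * (1 - (q : ℂ)⁻¹) + 2⁻¹ * (cp + cm) * ((q : ℂ)⁻¹ * (1 - (q : ℂ)⁻¹)) +
            c0 * ((q : ℂ) ^ 2)⁻¹)) := by
  have hq' : (q : ℂ) ≠ 0 := Nat.cast_ne_zero.mpr hq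
  have hq1 : (q : ℂ) + 1 ≠ 0 := by exact_mod_cast Nat.succ_ne_zero q
  have hrow := transferMatrix_leviRow_sum hq (κ₀ := E * G / Hm) (κ₁ := 2 / ((q : ℂ) + 1) * (E * G / Hm)) (κL := E * G / Hm) rfl
    (by field_simp) cbd creg cp cm c0
  rw [Fin.sum_univ_two]
  simp only [Matrix.cons_val_zero, Matrix.cons_val_one, mul_one]
  have h2 : E * G / Hm * (cbd * (-2 / (q : ℂ)) + creg * (-2 / (q : ℂ) ^ 2) + cp * (((q : ℂ) ^ 2 + (q : ℂ) - 1) / (q : ℂ) ^ 3) + cm * (((q : ℂ) ^ 2 + (q : ℂ) - 1) / (q : ℂ) ^ 3) +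
          c0 * (2 / (q : ℂ) ^ 3)) +
        (2 / ((q : ℂ) + 1) * (E * G / Hm)) * (cbd * (((q : ℂ) + 1) / (q : ℂ)) + creg * (((q : ℂ) + 1) / (q : ℂ) ^ 2) + cp * (-(((q : ℂ) + 1) * (2 * (q : ℂ) - 1)) / (2 * (q : ℂ) ^ 3)) +
          cm * (-(((q : ℂ) + 1) * (2 * (q : ℂ) - 1)) / (2 * (q : ℂ) ^ 3)) + c0 * (-1 / (q : ℂ) ^ 3)) * (((q : ℂ) + 1) / 2) =
      E * G / Hm * (cbd * (1 - ((q : ℂ))⁻¹) + creg * (((q : ℂ))⁻¹ * (1 - ((q : ℂ))⁻¹)) + cp * ((1 / 2) * ((q : ℂ))⁻¹ ^ 2 * (1 - ((q : ℂ))⁻¹)) +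
        cm * ((1 / 2) * ((q : ℂ))⁻¹ ^ 2 * (1 - ((q : ℂ))⁻¹)) + c0 * ((q : ℂ))⁻¹ ^ 3) := by
    rw [← hrow]; ring
  rw [h2]
  field_simp
  ring

/-! ## §2 The JOIN: one coefficient vector for Levi ∕ type (1) ∕ type (2) -/

set_option maxHeartbeats 1600000 in
/-- **THE JOIN AT A TAME-RAMIFIED PLACE, HYPOTHESIS-FORM** — for a `v`-level-one `K′`-class piece `g` with its two-layer strata values and `y_λ`: there is ONE coefficient vector `a : Fin 2 → ℂ` for the pinned test family `ψ^ram = (χ⁰, χ♯)` that (J) passes the LEVI test with `yv = (1, (q+1)∕2)` against the (L)-ram average bracket, (T1) gives the type-(1) row and (T2) the type-(2) row — `a := a(c)` the certificate row (masses pinned by ★ `masses_of_transferMatrix_leviRow`), (J) by the pure algebra `leviTest_of_transferMatrix` over ★ `transferMatrix_leviRow_sum`, (T1)(T2) by `typeOneRow_ram` ∕ `typeTwoRow_ram_of_counts` under the hypotheses `hCe hCo`. [cite: Rogawski1990, §4.9 Prop. 4.9.1 (a)(b) p. 55; §8.1 Prop. 8.1.1 p. 112] [cite: LanglandsShelstad1990Descent,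 §2.1 (2.1.2)] -/
theorem typeOneTwoRowsJoin_ram_of_counts
    (L : Type) [Field L] [NumberField L] [IsCMField L] (H' : Matrix (Fin 3) (Fin 3) L) (μ : HeckeCharacter L)
    {v : HeightOneSpectrum (𝓞 ↥(maximalRealSubfield L))}
    (hH' : (H'.map (cmConjRingHom L)).transpose = H') (w : PlacesOver L v)
    (hw : IsCMField.complexConj L • w.1 = w.1) (he : v.asIdeal.ramificationIdx' w.1.asIdeal ≠ 1)
    (hH'w : IsUnit (placeForm H' w.1)) (hH'i : hH'w.unit ∈ glInt 3 (w.1.adicCompletion L))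
    (hμu : μ.IsUnitary)
    (hμω : ∀ x : ideleGroup ↥(maximalRealSubfield L), μ (AdeleRing.ideleBaseChange ↥(maximalRealSubfield L) L x) = quadraticHeckeCharCM L x)
    (h2 : IsUnit (2 : 𝒪[w.1.adicCompletion L]))
    -- the ramified block (R) and the integral antidiagonal frame of `H′_w` (★ `ramifiedBlock_adicCompletion`, ★ p846344) — SUPPLIED by the contract, BINDERS for the sockets
    (ϖ : w.1.adicCompletion L) (hϖ : Valued.v ϖ = WithZero.exp (-1 : ℤ)) (hσϖ : galAdicCompletionMap (L := L) (IsCMField.complexConj L) hw ϖ = -ϖ)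
    (A : GL (Fin 3) (w.1.adicCompletion L)) (hA : A ∈ glInt 3 (w.1.adicCompletion L))
    (hframe : placeForm H' w.1 = (-(placeForm H' w.1).det) • formCongr (galAdicCompletionMap (L := L) (IsCMField.complexConj L) hw) A ((StdForm.antidiagonal 3).over (w.1.adicCompletion L)))
    [MeasurableSpace ((cmDatum L 3 H').Local v)] [BorelSpace ((cmDatum L 3 H').Local v)]
    [∀ γ : ((cmDatum L 3 H').Local v), MeasurableSpace (((cmDatum L 3 H').Local v) ⧸ Subgroup.centralizer ({γ} : Set ((cmDatum L 3 H').Local v)))]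
    [∀ γ : ((cmDatum L 3 H').Local v), BorelSpace (((cmDatum L 3 H').Local v) ⧸ Subgroup.centralizer ({γ} : Set ((cmDatum L 3 H').Local v)))]
    [MeasurableSpace ((cmDatum L 2 (Matrix.of fun i j : Fin 2 => if i.val + j.val + 1 = 2 then (1 : L) else 0)).Local v × (cmDatum L 1 (Matrix.of fun i j : Fin 1 => if i.val + j.val + 1 = 1 then (1 : L) else 0)).Local v)] [BorelSpace ((cmDatum L 2 (Matrix.of fun i j : Fin 2 => if i.val + j.val + 1 = 2 then (1 : L) else 0)).Local v × (cmDatum L 1 (Matrix.of fun i j : Fin 1 => if i.val + j.val + 1 = 1 then (1 : L) else 0)).Local v)]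
  [∀ a : (cmDatum L 2 (Matrix.of fun i j : Fin 2 => if i.val + j.val + 1 = 2 then (1 : L) else 0)).Local v × (cmDatum L 1 (Matrix.of fun i j : Fin 1 => if i.val + j.val + 1 = 1 then (1 : L) else 0)).Local v, MeasurableSpace (((cmDatum L 2 (Matrix.of fun i j : Fin 2 => if i.val + j.val + 1 = 2 then (1 : L) else 0)).Local v × (cmDatum L 1 (Matrix.of fun i j : Fin 1 => if i.val + j.val + 1 = 1 then (1 : L) else 0)).Local v) ⧸ Subgroup.centralizer ({a} : Set ((cmDatum L 2 (Matrix.of fun i j : Fin 2 => if i.val + j.val + 1 = 2 then (1 : L) else 0)).Local v × (cmDatum L 1 (Matrix.of fun i j : Fin 1 => if i.val + j.val + 1 = 1 then (1 : L) else 0)).Local v)))]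
  [∀ a : (cmDatum L 2 (Matrix.of fun i j : Fin 2 => if i.val + j.val + 1 = 2 then (1 : L) else 0)).Local v × (cmDatum L 1 (Matrix.of fun i j : Fin 1 => if i.val + j.val + 1 = 1 then (1 : L) else 0)).Local v, BorelSpace (((cmDatum L 2 (Matrix.of fun i j : Fin 2 => if i.val + j.val + 1 = 2 then (1 : L) else 0)).Local v × (cmDatum L 1 (Matrix.of fun i j : Fin 1 => if i.val + j.val + 1 = 1 then (1 : L) else 0)).Local v) ⧸ Subgroup.centralizer ({a} : Set ((cmDatum L 2 (Matrix.of fun i j : Fin 2 => if i.val + j.val + 1 = 2 then (1 : L) else 0)).Local v × (cmDatum L 1 (Matrix.of fun i j : Fin 1 => if i.val + j.val + 1 = 1 then (1 : L) else 0)).Local v)))]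
    (νH : Measure ((cmDatum L 2 (Matrix.of fun i j : Fin 2 => if i.val + j.val + 1 = 2 then (1 : L) else 0)).Local v × (cmDatum L 1 (Matrix.of fun i j : Fin 1 => if i.val + j.val + 1 = 1 then (1 : L) else 0)).Local v)) [νH.IsHaarMeasure] [νH.IsMulRightInvariant]
    (νG : Measure ((cmDatum L 3 H').Local v)) [νG.IsHaarMeasure] [νG.IsMulRightInvariant]
    {mH : OrbitalMeasureFamily ((cmDatum L 2 (Matrix.of fun i j : Fin 2 => if i.val + j.val + 1 = 2 then (1 : L) else 0)).Local v × (cmDatum L 1 (Matrix.of fun i j : Fin 1 => if i.val + j.val + 1 = 1 then (1 : L) else 0)).Local v)} {mG : OrbitalMeasureFamily ((cmDatum L 3 H').Local v)}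
    (hmH : mH.IsCanonical (IsLocalGRegular L v) νH)
    (hmG : mG.IsCanonical (fun γ => IsRegularElt (γ.val : GL (Fin 3) (UnitaryGroup.LocalRing L v))) νG)
    -- the piece: `C_c^∞`, supported in the hyperspecial `K`, `Ad K`-invariant, left-invariant under the level-2 congruence set (A-69 (β), `j = 2`)
    (g : ((cmDatum L 3 H').Local v) → ℂ) (hg : IsLocSmooth g) (hgK : tsupport g ⊆ (cmLocalIntegralLevel L 3 H' v : Set ((cmDatum L 3 H').Local v)))
    (hginv : ∀ u ∈ cmLocalIntegralLevel L 3 H' v, ∀ x, g (u * x * u⁻¹) = g x)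
    (hg1 : ∀ u : (cmDatum L 3 H').Local v,
      (∀ a b, Valued.v (((toPlace v w (HeckeCharacter.uniformizer ↥(maximalRealSubfield L) v : v.adicCompletion ↥(maximalRealSubfield L))) ^ 1)⁻¹ *
        ((((localNonsplitEquiv (IsCMField.complexConj L) H' (IsCMField.complexConj_ne_one L) w hw u :
            ↥(unitaryGroupOfForm (galAdicCompletionMap (L := L) (IsCMField.complexConj L) hw) (placeForm H' w.1))) : GL (Fin 3) (w.1.adicCompletion L)) :
              Matrix (Fin 3) (Fin 3) (w.1.adicCompletion L)) a b - (1 : Matrix (Fin 3) (Fin 3) (w.1.adicCompletion L)) a b)) ≤ 1) →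
      ∀ x, g (u * x) = g x)
    -- the two-layer strata values of `g` (★ F0P2-p01 head rows VERBATIM, in the (L)-ram L5-C2 binder shapes)
    (c₂ : ℂ) (c' : ℕ → ℂ) (hc : ∀ x : ((cmDatum L 3 H').Local v), (x ∈ cmLocalIntegralLevel L 3 H' v ∧ (redMat (((x).val : GL (Fin 3) (UnitaryGroup.LocalRing L v)).val.map (Pi.evalRingHom (fun w' : PlacesOver L v => w'.1.adicCompletion L) w)) - 1) ^ 3 = 0 ∧ (redMat (((x).val : GL (Fin 3) (UnitaryGroup.LocalRing L v)).val.map (Pi.evalRingHom (fun w' : PlacesOver L v => w'.1.adicCompletion L) w)) - 1).rank = 2 ∧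
        ∃ y : ((cmDatum L 3 H').Local v), (∀ a b, Valued.v (((toPlace v w (HeckeCharacter.uniformizer ↥(maximalRealSubfield L) v : v.adicCompletion ↥(maximalRealSubfield L))) ^ 1)⁻¹ *
        ((((localNonsplitEquiv (IsCMField.complexConj L) H' (IsCMField.complexConj_ne_one L) w hw (y * x * y⁻¹) :
            ↥(unitaryGroupOfForm (galAdicCompletionMap (L := L) (IsCMField.complexConj L) hw) (placeForm H' w.1))) : GL (Fin 3) (w.1.adicCompletion L)) :
              Matrix (Fin 3) (Fin 3) (w.1.adicCompletion L)) a b - (1 : Matrix (Fin 3) (Fin 3) (w.1.adicCompletion L)) a b)) ≤ 1)) → g x = c₂)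
    (hc' : ((∀ x : ((cmDatum L 3 H').Local v), (x ∈ cmLocalIntegralLevel L 3 H' v ∧ (∀ a b, Valued.v (ϖ⁻¹ * ((((x).val : GL (Fin 3) (UnitaryGroup.LocalRing L v)).val.map (Pi.evalRingHom (fun w' : PlacesOver L v => w'.1.adicCompletion L) w)) a b - (1 : Matrix (Fin 3) (Fin 3) (w.1.adicCompletion L)) a b)) ≤ 1) ∧
        (redMat (ϖ⁻¹ • ((((x).val : GL (Fin 3) (UnitaryGroup.LocalRing L v)).val.map (Pi.evalRingHom (fun w' : PlacesOver L v => w'.1.adicCompletion L) w)) - 1))) ^ 3 = 0 ∧ (redMat (ϖ⁻¹ • ((((x).val : GL (Fin 3) (UnitaryGroup.LocalRing L v)).val.map (Pi.evalRingHom (fun w' : PlacesOver L v => w'.1.adicCompletion L) w)) - 1))).rank = 0) → g x = c' 0) ∧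
      (∀ x : ((cmDatum L 3 H').Local v), (x ∈ cmLocalIntegralLevel L 3 H' v ∧ (∀ a b, Valued.v (ϖ⁻¹ * ((((x).val : GL (Fin 3) (UnitaryGroup.LocalRing L v)).val.map (Pi.evalRingHom (fun w' : PlacesOver L v => w'.1.adicCompletion L) w)) a b - (1 : Matrix (Fin 3) (Fin 3) (w.1.adicCompletion L)) a b)) ≤ 1) ∧
        (redMat (ϖ⁻¹ • ((((x).val : GL (Fin 3) (UnitaryGroup.LocalRing L v)).val.map (Pi.evalRingHom (fun w' : PlacesOver L v => w'.1.adicCompletion L) w)) - 1))) ^ 3 = 0 ∧ (redMat (ϖ⁻¹ • ((((x).val : GL (Fin 3) (UnitaryGroup.LocalRing L v)).val.map (Pi.evalRingHom (fun w' : PlacesOver L v => w'.1.adicCompletion L) w)) - 1))).rank = 2) → g x = c' 2)))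
    (c₁s c₁n : ℂ)
    (hR4s : (∀ (x : ((cmDatum L 3 H').Local v)) (z : Fin 3 → 𝓀[(w.1.adicCompletion L)]), (x ∈ cmLocalIntegralLevel L 3 H' v ∧
        (∀ a b, Valued.v (ϖ⁻¹ * ((((x).val : GL (Fin 3) (UnitaryGroup.LocalRing L v)).val.map (Pi.evalRingHom (fun w' : PlacesOver L v => w'.1.adicCompletion L) w)) a b - (1 : Matrix (Fin 3) (Fin 3) (w.1.adicCompletion L)) a b)) ≤ 1) ∧
        (redMat (ϖ⁻¹ • ((((x).val : GL (Fin 3) (UnitaryGroup.LocalRing L v)).val.map (Pi.evalRingHom (fun w' : PlacesOver L v => w'.1.adicCompletion L) w)) - 1))) ^ 3 = 0 ∧ (redMat (ϖ⁻¹ • ((((x).val : GL (Fin 3) (UnitaryGroup.LocalRing L v)).val.map (Pi.evalRingHom (fun w' : PlacesOver L v => w'.1.adicCompletion L) w)) - 1))).rank = 1 ∧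
        z ⬝ᵥ ((redMat (placeForm H' w.1) * redMat (ϖ⁻¹ • ((((x).val : GL (Fin 3) (UnitaryGroup.LocalRing L v)).val.map (Pi.evalRingHom (fun w' : PlacesOver L v => w'.1.adicCompletion L) w)) - 1))) *ᵥ z) ≠ 0 ∧ IsSquare (z ⬝ᵥ ((redMat (placeForm H' w.1) * redMat (ϖ⁻¹ • ((((x).val : GL (Fin 3) (UnitaryGroup.LocalRing L v)).val.map (Pi.evalRingHom (fun w' : PlacesOver L v => w'.1.adicCompletion L) w)) - 1))) *ᵥ z))) →
        g x = c₁s))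
    (hR4n : (∀ (x : ((cmDatum L 3 H').Local v)) (z : Fin 3 → 𝓀[(w.1.adicCompletion L)]), (x ∈ cmLocalIntegralLevel L 3 H' v ∧
        (∀ a b, Valued.v (ϖ⁻¹ * ((((x).val : GL (Fin 3) (UnitaryGroup.LocalRing L v)).val.map (Pi.evalRingHom (fun w' : PlacesOver L v => w'.1.adicCompletion L) w)) a b - (1 : Matrix (Fin 3) (Fin 3) (w.1.adicCompletion L)) a b)) ≤ 1) ∧
        (redMat (ϖ⁻¹ • ((((x).val : GL (Fin 3) (UnitaryGroup.LocalRing L v)).val.map (Pi.evalRingHom (fun w' : PlacesOver L v => w'.1.adicCompletion L) w)) - 1))) ^ 3 = 0 ∧ (redMat (ϖ⁻¹ • ((((x).val : GL (Fin 3) (UnitaryGroup.LocalRing L v)).val.map (Pi.evalRingHom (fun w' : PlacesOver L v => w'.1.adicCompletion L) w)) - 1))).rank = 1 ∧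
        z ⬝ᵥ ((redMat (placeForm H' w.1) * redMat (ϖ⁻¹ • ((((x).val : GL (Fin 3) (UnitaryGroup.LocalRing L v)).val.map (Pi.evalRingHom (fun w' : PlacesOver L v => w'.1.adicCompletion L) w)) - 1))) *ᵥ z) ≠ 0 ∧ ¬ IsSquare (z ⬝ᵥ ((redMat (placeForm H' w.1) * redMat (ϖ⁻¹ • ((((x).val : GL (Fin 3) (UnitaryGroup.LocalRing L v)).val.map (Pi.evalRingHom (fun w' : PlacesOver L v => w'.1.adicCompletion L) w)) - 1))) *ᵥ z))) →
        g x = c₁n))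
    -- `y_λ ∈ L⁺_v` with `ι_w y_λ = −det H′_w` (the C-Δ Levi value's Hilbert symbol `(y_λ, θ)_v`)
    (yl : v.adicCompletion ↥(maximalRealSubfield L)) (hyl : toPlace v w yl = -(placeForm H' w.1).det)
    (hCe : ∀ ⦃γH : ((cmDatum L 2 (Matrix.of fun i j : Fin 2 => if i.val + j.val + 1 = 2 then (1 : L) else 0)).Local v × (cmDatum L 1 (Matrix.of fun i j : Fin 1 => if i.val + j.val + 1 = 1 then (1 : L) else 0)).Local v)⦄,
      (∀ i j : Fin 2, Valued.v (((((γH.1.val : GL (Fin 2) (UnitaryGroup.LocalRing L v)).val.map (Pi.evalRingHom (fun w' : PlacesOver L v => w'.1.adicCompletion L) w))) - 1) i j) ≤ Valued.v (ϖ ^ 2)) → Valued.v (finGammaTwo L v γH w - 1) ≤ Valued.v (ϖ ^ 2) → IsLocalGRegular L v γH →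
      (¬ ∃ x : (w.1.adicCompletion L), ((((γH.1.val : GL (Fin 2) (UnitaryGroup.LocalRing L v)).val.map (Pi.evalRingHom (fun w' : PlacesOver L v => w'.1.adicCompletion L) w))).charpoly).IsRoot x) → ∀ ⦃n : ℕ⦄,
      Valued.v ((((γH.1.val : GL (Fin 2) (UnitaryGroup.LocalRing L v)).val.map (Pi.evalRingHom (fun w' : PlacesOver L v => w'.1.adicCompletion L) w))).trace ^ 2 - 4 * (((γH.1.val : GL (Fin 2) (UnitaryGroup.LocalRing L v)).val.map (Pi.evalRingHom (fun w' : PlacesOver L v => w'.1.adicCompletion L) w))).det) = WithZero.exp (-((2 * (2 * n) : ℕ) : ℤ)) → 1 ≤ n →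
      ∀ (m : ℕ), Valued.v (((finCharpolyTwo L v γH).eval (finGammaTwo L v γH)) w) =
          Valued.v ((toPlace v w (HeckeCharacter.uniformizer ↥(maximalRealSubfield L) v : v.adicCompletion ↥(maximalRealSubfield L))) ^ m) →
        ∀ β : (v.adicCompletion ↥(maximalRealSubfield L))ˣ,
          toPlace v w (β : v.adicCompletion ↥(maximalRealSubfield L)) =
            -(((finCharpolyTwo L v γH).eval (finGammaTwo L v γH)) w *
                (finGammaTwo L v γH w ^ 2 +
                  ((γH.1.val.val : Matrix (Fin 2) (Fin 2) (LocalRing L v)).map (Pi.evalRingHom (fun w' : PlacesOver L v => w'.1.adicCompletion L) w)).det)) /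
              (2 * finGammaTwo L v γH w ^ 2 *
                ((γH.1.val.val : Matrix (Fin 2) (Fin 2) (LocalRing L v)).map (Pi.evalRingHom (fun w' : PlacesOver L v => w'.1.adicCompletion L) w)).det) →
      ∀ tp tm : ((cmDatum L 3 H').Local v), IsLocalNormPair L H' v γH tp → IsLocalNormPair L H' v γH tm → finKappaAt L v H' γH tp = 1 → finKappaAt L v H' γH tm = -1 →
        (∀ a b, Valued.v (((toPlace v w (HeckeCharacter.uniformizer ↥(maximalRealSubfield L) v : v.adicCompletion ↥(maximalRealSubfield L))) ^ 1)⁻¹ * ((((tp).val : GL (Fin 3) (UnitaryGroup.LocalRing L v)).val.map (Pi.evalRingHom (fun w' : PlacesOver L v => w'.1.adicCompletion L) w)) a b - (1 : Matrix (Fin 3) (Fin 3) (w.1.adicCompletion L)) a b)) ≤ 1) → (∀ a b, Valued.v (((toPlace v w (HeckeCharacter.uniformizer ↥(maximalRealSubfield L) v : v.adicCompletion ↥(maximalRealSubfield L))) ^ 1)⁻¹ * ((((tm).val : GL (Fin 3) (UnitaryGroup.LocalRing L v)).val.map (Pi.evalRingHom (fun w' : PlacesOver L v => w'.1.adicCompletion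 L) w)) a b - (1 : Matrix (Fin 3) (Fin 3) (w.1.adicCompletion L)) a b)) ≤ 1) →
        ((hilbertSymbol (v.adicCompletion ↥(maximalRealSubfield L)) (β : v.adicCompletion ↥(maximalRealSubfield L))
        (algebraMap ↥(maximalRealSubfield L) _ ((cmQuadraticGenerator L : 𝓞 ↥(maximalRealSubfield L)) : ↥(maximalRealSubfield L))) : ℂ) * ((Ideal.absNorm v.asIdeal : ℂ) ^ m)⁻¹) * (({q : (((cmDatum L 3 H').Local v) ⧸ cmLocalIntegralLevel L 3 H' v) | q ∈ MulAction.fixedBy (((cmDatum L 3 H').Local v) ⧸ cmLocalIntegralLevel L 3 H' v) tp ∧ (redMat (((((q.out⁻¹ * tp * q.out)).val : GL (Fin 3) (UnitaryGroup.LocalRing L v)).val.map (Pi.evalRingHom (fun w' : PlacesOver L v => w'.1.adicCompletion L) w))) - 1).rank = 2}.ncard : ℂ) - ({q : (((cmDatum L 3 H').Local v) ⧸ cmLocalIntegralLevel L 3 H' v) | q ∈ MulAction.fixedBy (((cmDatum L 3 H').Local v) ⧸ cmLocalIntegralLevel L 3 H' v) tm ∧ (redMat (((((q.out⁻¹ *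 tm * q.out)).val : GL (Fin 3) (UnitaryGroup.LocalRing L v)).val.map (Pi.evalRingHom (fun w' : PlacesOver L v => w'.1.adicCompletion L) w))) - 1).rank = 2}.ncard : ℂ)) = (hilbertSymbol (v.adicCompletion ↥(maximalRealSubfield L)) yl
        (algebraMap ↥(maximalRealSubfield L) _ ((cmQuadraticGenerator L : 𝓞 ↥(maximalRealSubfield L)) : ↥(maximalRealSubfield L))) : ℂ) * (((Ideal.absNorm v.asIdeal : ℂ) + 1) * (Ideal.absNorm v.asIdeal : ℂ) ^ n / (Ideal.absNorm v.asIdeal : ℂ)) ∧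
        ((hilbertSymbol (v.adicCompletion ↥(maximalRealSubfield L)) (β : v.adicCompletion ↥(maximalRealSubfield L))
        (algebraMap ↥(maximalRealSubfield L) _ ((cmQuadraticGenerator L : 𝓞 ↥(maximalRealSubfield L)) : ↥(maximalRealSubfield L))) : ℂ) * ((Ideal.absNorm v.asIdeal : ℂ) ^ m)⁻¹) * (({q : (((cmDatum L 3 H').Local v) ⧸ cmLocalIntegralLevel L 3 H' v) | q ∈ MulAction.fixedBy (((cmDatum L 3 H').Local v) ⧸ cmLocalIntegralLevel L 3 H' v) tp ∧ (redMat (((((q.out⁻¹ * tp * q.out)).val : GL (Fin 3) (UnitaryGroup.LocalRing L v)).val.map (Pi.evalRingHom (fun w' : PlacesOver L v => w'.1.adicCompletion L) w))) - 1).rank = 0 ∧ (redMat (ϖ⁻¹ • (((((q.out⁻¹ * tp * q.out)).val : GL (Fin 3) (UnitaryGroup.LocalRing L v)).val.map (Pi.evalRingHom (fun w' : PlacesOver L v => w'.1.adicCompletion L) w)) - 1))).rank = 2}.ncard : ℂ) - ({q : (((cmDatum L 3 H').Local v) ⧸ cmLocalIntegralLevel L 3 H' v) | q ∈ MulAction.fixedBy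 (((cmDatum L 3 H').Local v) ⧸ cmLocalIntegralLevel L 3 H' v) tm ∧ (redMat (((((q.out⁻¹ * tm * q.out)).val : GL (Fin 3) (UnitaryGroup.LocalRing L v)).val.map (Pi.evalRingHom (fun w' : PlacesOver L v => w'.1.adicCompletion L) w))) - 1).rank = 0 ∧ (redMat (ϖ⁻¹ • (((((q.out⁻¹ * tm * q.out)).val : GL (Fin 3) (UnitaryGroup.LocalRing L v)).val.map (Pi.evalRingHom (fun w' : PlacesOver L v => w'.1.adicCompletion L) w)) - 1))).rank = 2}.ncard : ℂ)) = (hilbertSymbol (v.adicCompletion ↥(maximalRealSubfield L)) yl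
        (algebraMap ↥(maximalRealSubfield L) _ ((cmQuadraticGenerator L : 𝓞 ↥(maximalRealSubfield L)) : ↥(maximalRealSubfield L))) : ℂ) * (((Ideal.absNorm v.asIdeal : ℂ) + 1) * (Ideal.absNorm v.asIdeal : ℂ) ^ n / (Ideal.absNorm v.asIdeal : ℂ) ^ 2) ∧
        ((hilbertSymbol (v.adicCompletion ↥(maximalRealSubfield L)) (β : v.adicCompletion ↥(maximalRealSubfield L))
        (algebraMap ↥(maximalRealSubfield L) _ ((cmQuadraticGenerator L : 𝓞 ↥(maximalRealSubfield L)) : ↥(maximalRealSubfield L))) : ℂ) * ((Ideal.absNorm v.asIdeal : ℂ) ^ m)⁻¹) * (({q : (((cmDatum L 3 H').Local v) ⧸ cmLocalIntegralLevel L 3 H' v) | q ∈ MulAction.fixedBy (((cmDatum L 3 H').Local v) ⧸ cmLocalIntegralLevel L 3 H' v) tp ∧ (redMat (((((q.out⁻¹ * tp * q.out)).val : GL (Fin 3) (UnitaryGroup.LocalRing L v)).val.map (Pi.evalRingHom (fun w' : PlacesOver L v => w'.1.adicCompletion L) w))) - 1).rank = 0 ∧ (redMat (ϖ⁻¹ •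 (((((q.out⁻¹ * tp * q.out)).val : GL (Fin 3) (UnitaryGroup.LocalRing L v)).val.map (Pi.evalRingHom (fun w' : PlacesOver L v => w'.1.adicCompletion L) w)) - 1))).rank = 1 ∧ ∃ (z : Fin 3 → 𝓀[(w.1.adicCompletion L)]) (a : 𝓀[(w.1.adicCompletion L)]), a ≠ 0 ∧ z ⬝ᵥ ((redMat (placeForm H' w.1) * redMat (ϖ⁻¹ • (((((q.out⁻¹ * tp * q.out)).val : GL (Fin 3) (UnitaryGroup.LocalRing L v)).val.map (Pi.evalRingHom (fun w' : PlacesOver L v => w'.1.adicCompletion L) w)) - 1))) *ᵥ z) = a ^ 2}.ncard : ℂ) - ({q : (((cmDatum L 3 H').Local v) ⧸ cmLocalIntegralLevel L 3 H' v) | q ∈ MulAction.fixedBy (((cmDatum L 3 H').Local v) ⧸ cmLocalIntegralLevel L 3 H' v) tm ∧ (redMat (((((q.out⁻¹ * tm * q.out)).val : GL (Fin 3) (UnitaryGroup.LocalRing L v)).val.map (Pi.evalRingHom (fun w' : PlacesOver L v => w'.1.adicCompletion L) w))) - 1).rank = 0 ∧ (redMat (ϖ⁻¹ • (((((q.out⁻¹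 * tm * q.out)).val : GL (Fin 3) (UnitaryGroup.LocalRing L v)).val.map (Pi.evalRingHom (fun w' : PlacesOver L v => w'.1.adicCompletion L) w)) - 1))).rank = 1 ∧ ∃ (z : Fin 3 → 𝓀[(w.1.adicCompletion L)]) (a : 𝓀[(w.1.adicCompletion L)]), a ≠ 0 ∧ z ⬝ᵥ ((redMat (placeForm H' w.1) * redMat (ϖ⁻¹ • (((((q.out⁻¹ * tm * q.out)).val : GL (Fin 3) (UnitaryGroup.LocalRing L v)).val.map (Pi.evalRingHom (fun w' : PlacesOver L v => w'.1.adicCompletion L) w)) - 1))) *ᵥ z) = a ^ 2}.ncard : ℂ)) = (hilbertSymbol (v.adicCompletion ↥(maximalRealSubfield L)) yl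
        (algebraMap ↥(maximalRealSubfield L) _ ((cmQuadraticGenerator L : 𝓞 ↥(maximalRealSubfield L)) : ↥(maximalRealSubfield L))) : ℂ) * (((Ideal.absNorm v.asIdeal : ℂ) + 1) * ((Ideal.absNorm v.asIdeal : ℂ) ^ n - 2 * (Ideal.absNorm v.asIdeal : ℂ)) / (2 * (Ideal.absNorm v.asIdeal : ℂ) ^ 3)) ∧
        ((hilbertSymbol (v.adicCompletion ↥(maximalRealSubfield L)) (β : v.adicCompletion ↥(maximalRealSubfield L))
        (algebraMap ↥(maximalRealSubfield L) _ ((cmQuadraticGenerator L : 𝓞 ↥(maximalRealSubfield L)) : ↥(maximalRealSubfield L))) : ℂ) * ((Ideal.absNorm v.asIdeal : ℂ) ^ m)⁻¹) * (({q : (((cmDatum L 3 H').Local v) ⧸ cmLocalIntegralLevel L 3 H' v) | q ∈ MulAction.fixedBy (((cmDatum L 3 H').Local v) ⧸ cmLocalIntegralLevel L 3 H' v) tp ∧ (redMat (((((q.out⁻¹ * tp * q.out)).val : GL (Fin 3) (UnitaryGroup.LocalRing L v)).val.map (Pi.evalRingHom (fun w' : PlacesOver L v => w'.1.adicCompletion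 L) w))) - 1).rank = 0 ∧ (redMat (ϖ⁻¹ • (((((q.out⁻¹ * tp * q.out)).val : GL (Fin 3) (UnitaryGroup.LocalRing L v)).val.map (Pi.evalRingHom (fun w' : PlacesOver L v => w'.1.adicCompletion L) w)) - 1))).rank = 1 ∧ ¬ ∃ (z : Fin 3 → 𝓀[(w.1.adicCompletion L)]) (a : 𝓀[(w.1.adicCompletion L)]), a ≠ 0 ∧ z ⬝ᵥ ((redMat (placeForm H' w.1) * redMat (ϖ⁻¹ • (((((q.out⁻¹ * tp * q.out)).val : GL (Fin 3) (UnitaryGroup.LocalRing L v)).val.map (Pi.evalRingHom (fun w' : PlacesOver L v => w'.1.adicCompletion L) w)) - 1))) *ᵥ z) = a ^ 2}.ncard : ℂ) - ({q : (((cmDatum L 3 H').Local v) ⧸ cmLocalIntegralLevel L 3 H' v) | q ∈ MulAction.fixedBy (((cmDatum L 3 H').Local v) ⧸ cmLocalIntegralLevel L 3 H' v) tm ∧ (redMat (((((q.out⁻¹ * tm * q.out)).val : GL (Fin 3) (UnitaryGroup.LocalRing L v)).val.map (Pi.evalRingHom (fun w' : PlacesOver L v => w'.1.adicCompletion L) w)))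 - 1).rank = 0 ∧ (redMat (ϖ⁻¹ • (((((q.out⁻¹ * tm * q.out)).val : GL (Fin 3) (UnitaryGroup.LocalRing L v)).val.map (Pi.evalRingHom (fun w' : PlacesOver L v => w'.1.adicCompletion L) w)) - 1))).rank = 1 ∧ ¬ ∃ (z : Fin 3 → 𝓀[(w.1.adicCompletion L)]) (a : 𝓀[(w.1.adicCompletion L)]), a ≠ 0 ∧ z ⬝ᵥ ((redMat (placeForm H' w.1) * redMat (ϖ⁻¹ • (((((q.out⁻¹ * tm * q.out)).val : GL (Fin 3) (UnitaryGroup.LocalRing L v)).val.map (Pi.evalRingHom (fun w' : PlacesOver L v => w'.1.adicCompletion L) w)) - 1))) *ᵥ z) = a ^ 2}.ncard : ℂ)) = (hilbertSymbol (v.adicCompletion ↥(maximalRealSubfield L)) yl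
        (algebraMap ↥(maximalRealSubfield L) _ ((cmQuadraticGenerator L : 𝓞 ↥(maximalRealSubfield L)) : ↥(maximalRealSubfield L))) : ℂ) * (((Ideal.absNorm v.asIdeal : ℂ) + 1) * ((Ideal.absNorm v.asIdeal : ℂ) ^ n - 2 * (Ideal.absNorm v.asIdeal : ℂ)) / (2 * (Ideal.absNorm v.asIdeal : ℂ) ^ 3)) ∧
        ((hilbertSymbol (v.adicCompletion ↥(maximalRealSubfield L)) (β : v.adicCompletion ↥(maximalRealSubfield L))
        (algebraMap ↥(maximalRealSubfield L) _ ((cmQuadraticGenerator L : 𝓞 ↥(maximalRealSubfield L)) : ↥(maximalRealSubfield L))) : ℂ) * ((Ideal.absNorm v.asIdeal : ℂ) ^ m)⁻¹) * (({q : (((cmDatum L 3 H').Local v) ⧸ cmLocalIntegralLevel L 3 H' v) | q ∈ MulAction.fixedBy (((cmDatum L 3 H').Local v) ⧸ cmLocalIntegralLevel L 3 H' v) tp ∧ (redMat (((((q.out⁻¹ * tp * q.out)).val : GL (Fin 3) (UnitaryGroup.LocalRing L v)).val.map (Pi.evalRingHom (fun w' : PlacesOver L v => w'.1.adicCompletion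 L) w))) - 1).rank = 0 ∧ (redMat (ϖ⁻¹ • (((((q.out⁻¹ * tp * q.out)).val : GL (Fin 3) (UnitaryGroup.LocalRing L v)).val.map (Pi.evalRingHom (fun w' : PlacesOver L v => w'.1.adicCompletion L) w)) - 1))).rank = 0}.ncard : ℂ) - ({q : (((cmDatum L 3 H').Local v) ⧸ cmLocalIntegralLevel L 3 H' v) | q ∈ MulAction.fixedBy (((cmDatum L 3 H').Local v) ⧸ cmLocalIntegralLevel L 3 H' v) tm ∧ (redMat (((((q.out⁻¹ * tm * q.out)).val : GL (Fin 3) (UnitaryGroup.LocalRing L v)).val.map (Pi.evalRingHom (fun w' : PlacesOver L v => w'.1.adicCompletion L) w))) - 1).rank = 0 ∧ (redMat (ϖ⁻¹ • (((((q.out⁻¹ * tm * q.out)).val : GL (Fin 3) (UnitaryGroup.LocalRing L v)).val.map (Pi.evalRingHom (fun w' : PlacesOver L v => w'.1.adicCompletion L) w)) - 1))).rank = 0}.ncard : ℂ)) = (hilbertSymbol (v.adicCompletion ↥(maximalRealSubfield L)) yl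
        (algebraMap ↥(maximalRealSubfield L) _ ((cmQuadraticGenerator L : 𝓞 ↥(maximalRealSubfield L)) : ↥(maximalRealSubfield L))) : ℂ) * (((((Ideal.absNorm v.asIdeal : ℂ) + 1) * ∑ k ∈ Finset.range n, (Ideal.absNorm v.asIdeal : ℂ) ^ k) - 1) / (Ideal.absNorm v.asIdeal : ℂ) ^ 3))
    (hCo : ∀ ⦃γH : ((cmDatum L 2 (Matrix.of fun i j : Fin 2 => if i.val + j.val + 1 = 2 then (1 : L) else 0)).Local v × (cmDatum L 1 (Matrix.of fun i j : Fin 1 => if i.val + j.val + 1 = 1 then (1 : L) else 0)).Local v)⦄,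
      (∀ i j : Fin 2, Valued.v (((((γH.1.val : GL (Fin 2) (UnitaryGroup.LocalRing L v)).val.map (Pi.evalRingHom (fun w' : PlacesOver L v => w'.1.adicCompletion L) w))) - 1) i j) ≤ Valued.v (ϖ ^ 2)) → Valued.v (finGammaTwo L v γH w - 1) ≤ Valued.v (ϖ ^ 2) → IsLocalGRegular L v γH →
      (¬ ∃ x : (w.1.adicCompletion L), ((((γH.1.val : GL (Fin 2) (UnitaryGroup.LocalRing L v)).val.map (Pi.evalRingHom (fun w' : PlacesOver L v => w'.1.adicCompletion L) w))).charpoly).IsRoot x) → ∀ ⦃n : ℕ⦄,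
      Valued.v ((((γH.1.val : GL (Fin 2) (UnitaryGroup.LocalRing L v)).val.map (Pi.evalRingHom (fun w' : PlacesOver L v => w'.1.adicCompletion L) w))).trace ^ 2 - 4 * (((γH.1.val : GL (Fin 2) (UnitaryGroup.LocalRing L v)).val.map (Pi.evalRingHom (fun w' : PlacesOver L v => w'.1.adicCompletion L) w))).det) = WithZero.exp (-((2 * (2 * n + 1) : ℕ) : ℤ)) → 1 ≤ n →
      ∀ (m : ℕ), Valued.v (((finCharpolyTwo L v γH).eval (finGammaTwo L v γH)) w) =
          Valued.v ((toPlace v w (HeckeCharacter.uniformizer ↥(maximalRealSubfield L) v : v.adicCompletion ↥(maximalRealSubfield L))) ^ m) →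
        ∀ β : (v.adicCompletion ↥(maximalRealSubfield L))ˣ,
          toPlace v w (β : v.adicCompletion ↥(maximalRealSubfield L)) =
            -(((finCharpolyTwo L v γH).eval (finGammaTwo L v γH)) w *
                (finGammaTwo L v γH w ^ 2 +
                  ((γH.1.val.val : Matrix (Fin 2) (Fin 2) (LocalRing L v)).map (Pi.evalRingHom (fun w' : PlacesOver L v => w'.1.adicCompletion L) w)).det)) /
              (2 * finGammaTwo L v γH w ^ 2 *
                ((γH.1.val.val : Matrix (Fin 2) (Fin 2) (LocalRing L v)).map (Pi.evalRingHom (fun w' : PlacesOver L v => w'.1.adicCompletion L) w)).det) →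
      ∀ tp tm : ((cmDatum L 3 H').Local v), IsLocalNormPair L H' v γH tp → IsLocalNormPair L H' v γH tm → finKappaAt L v H' γH tp = 1 → finKappaAt L v H' γH tm = -1 →
        (∀ a b, Valued.v (((toPlace v w (HeckeCharacter.uniformizer ↥(maximalRealSubfield L) v : v.adicCompletion ↥(maximalRealSubfield L))) ^ 1)⁻¹ * ((((tp).val : GL (Fin 3) (UnitaryGroup.LocalRing L v)).val.map (Pi.evalRingHom (fun w' : PlacesOver L v => w'.1.adicCompletion L) w)) a b - (1 : Matrix (Fin 3) (Fin 3) (w.1.adicCompletion L)) a b)) ≤ 1) → (∀ a b, Valued.v (((toPlace v w (HeckeCharacter.uniformizer ↥(maximalRealSubfield L) v : v.adicCompletion ↥(maximalRealSubfield L))) ^ 1)⁻¹ * ((((tm).val : GL (Fin 3) (UnitaryGroup.LocalRing L v)).val.map (Pi.evalRingHom (fun w' : PlacesOver L v => w'.1.adicCompletion L) w)) a b - (1 : Matrix (Fin 3) (Fin 3) (w.1.adicCompletion L)) a b)) ≤ 1) →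
        ((hilbertSymbol (v.adicCompletion ↥(maximalRealSubfield L)) (β : v.adicCompletion ↥(maximalRealSubfield L))
        (algebraMap ↥(maximalRealSubfield L) _ ((cmQuadraticGenerator L : 𝓞 ↥(maximalRealSubfield L)) : ↥(maximalRealSubfield L))) : ℂ) * ((Ideal.absNorm v.asIdeal : ℂ) ^ m)⁻¹) * (({q : (((cmDatum L 3 H').Local v) ⧸ cmLocalIntegralLevel L 3 H' v) | q ∈ MulAction.fixedBy (((cmDatum L 3 H').Local v) ⧸ cmLocalIntegralLevel L 3 H' v) tp ∧ (redMat (((((q.out⁻¹ * tp * q.out)).val : GL (Fin 3) (UnitaryGroup.LocalRing L v)).val.map (Pi.evalRingHom (fun w' : PlacesOver L v => w'.1.adicCompletion L) w))) - 1).rank = 2}.ncard : ℂ) - ({q : (((cmDatum L 3 H').Local v) ⧸ cmLocalIntegralLevel L 3 H' v) | q ∈ MulAction.fixedBy (((cmDatum L 3 H').Local v) ⧸ cmLocalIntegralLevel L 3 H' v) tm ∧ (redMat (((((q.out⁻¹ * tm * q.out)).val : GL (Fin 3) (UnitaryGroup.LocalRing L v)).val.map (Pi.evalRingHom (fun w'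 : PlacesOver L v => w'.1.adicCompletion L) w))) - 1).rank = 2}.ncard : ℂ)) = (hilbertSymbol (v.adicCompletion ↥(maximalRealSubfield L)) yl
        (algebraMap ↥(maximalRealSubfield L) _ ((cmQuadraticGenerator L : 𝓞 ↥(maximalRealSubfield L)) : ↥(maximalRealSubfield L))) : ℂ) * (2 * (Ideal.absNorm v.asIdeal : ℂ) ^ n) ∧
        ((hilbertSymbol (v.adicCompletion ↥(maximalRealSubfield L)) (β : v.adicCompletion ↥(maximalRealSubfield L))
        (algebraMap ↥(maximalRealSubfield L) _ ((cmQuadraticGenerator L : 𝓞 ↥(maximalRealSubfield L)) : ↥(maximalRealSubfield L))) : ℂ) * ((Ideal.absNorm v.asIdeal : ℂ) ^ m)⁻¹) * (({q : (((cmDatum L 3 H').Local v) ⧸ cmLocalIntegralLevel L 3 H' v) | q ∈ MulAction.fixedBy (((cmDatum L 3 H').Local v) ⧸ cmLocalIntegralLevel L 3 H' v) tp ∧ (redMat (((((q.out⁻¹ * tp * q.out)).val : GL (Fin 3) (UnitaryGroup.LocalRing L v)).val.map (Pi.evalRingHom (fun w' : PlacesOver L v => w'.1.adicCompletion L) w)))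 - 1).rank = 0 ∧ (redMat (ϖ⁻¹ • (((((q.out⁻¹ * tp * q.out)).val : GL (Fin 3) (UnitaryGroup.LocalRing L v)).val.map (Pi.evalRingHom (fun w' : PlacesOver L v => w'.1.adicCompletion L) w)) - 1))).rank = 2}.ncard : ℂ) - ({q : (((cmDatum L 3 H').Local v) ⧸ cmLocalIntegralLevel L 3 H' v) | q ∈ MulAction.fixedBy (((cmDatum L 3 H').Local v) ⧸ cmLocalIntegralLevel L 3 H' v) tm ∧ (redMat (((((q.out⁻¹ * tm * q.out)).val : GL (Fin 3) (UnitaryGroup.LocalRing L v)).val.map (Pi.evalRingHom (fun w' : PlacesOver L v => w'.1.adicCompletion L) w))) - 1).rank = 0 ∧ (redMat (ϖ⁻¹ • (((((q.out⁻¹ * tm * q.out)).val : GL (Fin 3) (UnitaryGroup.LocalRing L v)).val.map (Pi.evalRingHom (fun w' : PlacesOver L v => w'.1.adicCompletion L) w)) - 1))).rank = 2}.ncard : ℂ)) = (hilbertSymbol (v.adicCompletion ↥(maximalRealSubfield L)) yl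
        (algebraMap ↥(maximalRealSubfield L) _ ((cmQuadraticGenerator L : 𝓞 ↥(maximalRealSubfield L)) : ↥(maximalRealSubfield L))) : ℂ) * (2 * (Ideal.absNorm v.asIdeal : ℂ) ^ n / (Ideal.absNorm v.asIdeal : ℂ)) ∧
        ((hilbertSymbol (v.adicCompletion ↥(maximalRealSubfield L)) (β : v.adicCompletion ↥(maximalRealSubfield L))
        (algebraMap ↥(maximalRealSubfield L) _ ((cmQuadraticGenerator L : 𝓞 ↥(maximalRealSubfield L)) : ↥(maximalRealSubfield L))) : ℂ) * ((Ideal.absNorm v.asIdeal : ℂ) ^ m)⁻¹) * (({q : (((cmDatum L 3 H').Local v) ⧸ cmLocalIntegralLevel L 3 H' v) | q ∈ MulAction.fixedBy (((cmDatum L 3 H').Local v) ⧸ cmLocalIntegralLevel L 3 H' v) tp ∧ (redMat (((((q.out⁻¹ * tp * q.out)).val : GL (Fin 3) (UnitaryGroup.LocalRing L v)).val.map (Pi.evalRingHom (fun w' : PlacesOver L v => w'.1.adicCompletion L) w))) - 1).rank = 0 ∧ (redMat (ϖ⁻¹ • (((((q.out⁻¹ * tp * q.out)).val : GL (Fin 3)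 (UnitaryGroup.LocalRing L v)).val.map (Pi.evalRingHom (fun w' : PlacesOver L v => w'.1.adicCompletion L) w)) - 1))).rank = 1 ∧ ∃ (z : Fin 3 → 𝓀[(w.1.adicCompletion L)]) (a : 𝓀[(w.1.adicCompletion L)]), a ≠ 0 ∧ z ⬝ᵥ ((redMat (placeForm H' w.1) * redMat (ϖ⁻¹ • (((((q.out⁻¹ * tp * q.out)).val : GL (Fin 3) (UnitaryGroup.LocalRing L v)).val.map (Pi.evalRingHom (fun w' : PlacesOver L v => w'.1.adicCompletion L) w)) - 1))) *ᵥ z) = a ^ 2}.ncard : ℂ) - ({q : (((cmDatum L 3 H').Local v) ⧸ cmLocalIntegralLevel L 3 H' v) | q ∈ MulAction.fixedBy (((cmDatum L 3 H').Local v) ⧸ cmLocalIntegralLevel L 3 H' v) tm ∧ (redMat (((((q.out⁻¹ * tm * q.out)).val : GL (Fin 3) (UnitaryGroup.LocalRing L v)).val.map (Pi.evalRingHom (fun w' : PlacesOver L v => w'.1.adicCompletion L) w))) - 1).rank = 0 ∧ (redMat (ϖ⁻¹ • (((((q.out⁻¹ * tm * q.out)).val : GL (Fin 3) (UnitaryGroup.LocalRing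 L v)).val.map (Pi.evalRingHom (fun w' : PlacesOver L v => w'.1.adicCompletion L) w)) - 1))).rank = 1 ∧ ∃ (z : Fin 3 → 𝓀[(w.1.adicCompletion L)]) (a : 𝓀[(w.1.adicCompletion L)]), a ≠ 0 ∧ z ⬝ᵥ ((redMat (placeForm H' w.1) * redMat (ϖ⁻¹ • (((((q.out⁻¹ * tm * q.out)).val : GL (Fin 3) (UnitaryGroup.LocalRing L v)).val.map (Pi.evalRingHom (fun w' : PlacesOver L v => w'.1.adicCompletion L) w)) - 1))) *ᵥ z) = a ^ 2}.ncard : ℂ)) = (hilbertSymbol (v.adicCompletion ↥(maximalRealSubfield L)) yl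
        (algebraMap ↥(maximalRealSubfield L) _ ((cmQuadraticGenerator L : 𝓞 ↥(maximalRealSubfield L)) : ↥(maximalRealSubfield L))) : ℂ) * (((Ideal.absNorm v.asIdeal : ℂ) ^ n - (Ideal.absNorm v.asIdeal : ℂ) - 1) / (Ideal.absNorm v.asIdeal : ℂ) ^ 2) ∧
        ((hilbertSymbol (v.adicCompletion ↥(maximalRealSubfield L)) (β : v.adicCompletion ↥(maximalRealSubfield L))
        (algebraMap ↥(maximalRealSubfield L) _ ((cmQuadraticGenerator L : 𝓞 ↥(maximalRealSubfield L)) : ↥(maximalRealSubfield L))) : ℂ) * ((Ideal.absNorm v.asIdeal : ℂ) ^ m)⁻¹) * (({q : (((cmDatum L 3 H').Local v) ⧸ cmLocalIntegralLevel L 3 H' v) | q ∈ MulAction.fixedBy (((cmDatum L 3 H').Local v) ⧸ cmLocalIntegralLevel L 3 H' v) tp ∧ (redMat (((((q.out⁻¹ * tp * q.out)).val : GL (Fin 3) (UnitaryGroup.LocalRing L v)).val.map (Pi.evalRingHom (fun w' : PlacesOver L v => w'.1.adicCompletion L) w))) - 1).rank = 0 ∧ (redMat (ϖ⁻¹ •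 (((((q.out⁻¹ * tp * q.out)).val : GL (Fin 3) (UnitaryGroup.LocalRing L v)).val.map (Pi.evalRingHom (fun w' : PlacesOver L v => w'.1.adicCompletion L) w)) - 1))).rank = 1 ∧ ¬ ∃ (z : Fin 3 → 𝓀[(w.1.adicCompletion L)]) (a : 𝓀[(w.1.adicCompletion L)]), a ≠ 0 ∧ z ⬝ᵥ ((redMat (placeForm H' w.1) * redMat (ϖ⁻¹ • (((((q.out⁻¹ * tp * q.out)).val : GL (Fin 3) (UnitaryGroup.LocalRing L v)).val.map (Pi.evalRingHom (fun w' : PlacesOver L v => w'.1.adicCompletion L) w)) - 1))) *ᵥ z) = a ^ 2}.ncard : ℂ) - ({q : (((cmDatum L 3 H').Local v) ⧸ cmLocalIntegralLevel L 3 H' v) | q ∈ MulAction.fixedBy (((cmDatum L 3 H').Local v) ⧸ cmLocalIntegralLevel L 3 H' v) tm ∧ (redMat (((((q.out⁻¹ * tm * q.out)).val : GL (Fin 3) (UnitaryGroup.LocalRing L v)).val.map (Pi.evalRingHom (fun w' : PlacesOver L v => w'.1.adicCompletion L) w))) - 1).rank = 0 ∧ (redMat (ϖ⁻¹ • (((((q.out⁻¹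 * tm * q.out)).val : GL (Fin 3) (UnitaryGroup.LocalRing L v)).val.map (Pi.evalRingHom (fun w' : PlacesOver L v => w'.1.adicCompletion L) w)) - 1))).rank = 1 ∧ ¬ ∃ (z : Fin 3 → 𝓀[(w.1.adicCompletion L)]) (a : 𝓀[(w.1.adicCompletion L)]), a ≠ 0 ∧ z ⬝ᵥ ((redMat (placeForm H' w.1) * redMat (ϖ⁻¹ • (((((q.out⁻¹ * tm * q.out)).val : GL (Fin 3) (UnitaryGroup.LocalRing L v)).val.map (Pi.evalRingHom (fun w' : PlacesOver L v => w'.1.adicCompletion L) w)) - 1))) *ᵥ z) = a ^ 2}.ncard : ℂ)) = (hilbertSymbol (v.adicCompletion ↥(maximalRealSubfield L)) yl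
        (algebraMap ↥(maximalRealSubfield L) _ ((cmQuadraticGenerator L : 𝓞 ↥(maximalRealSubfield L)) : ↥(maximalRealSubfield L))) : ℂ) * (((Ideal.absNorm v.asIdeal : ℂ) ^ n - (Ideal.absNorm v.asIdeal : ℂ) - 1) / (Ideal.absNorm v.asIdeal : ℂ) ^ 2) ∧
        ((hilbertSymbol (v.adicCompletion ↥(maximalRealSubfield L)) (β : v.adicCompletion ↥(maximalRealSubfield L))
        (algebraMap ↥(maximalRealSubfield L) _ ((cmQuadraticGenerator L : 𝓞 ↥(maximalRealSubfield L)) : ↥(maximalRealSubfield L))) : ℂ) * ((Ideal.absNorm v.asIdeal : ℂ) ^ m)⁻¹) * (({q : (((cmDatum L 3 H').Local v) ⧸ cmLocalIntegralLevel L 3 H' v) | q ∈ MulAction.fixedBy (((cmDatum L 3 H').Local v) ⧸ cmLocalIntegralLevel L 3 H' v) tp ∧ (redMat (((((q.out⁻¹ * tp * q.out)).val : GL (Fin 3) (UnitaryGroup.LocalRing L v)).val.map (Pi.evalRingHom (fun w' : PlacesOver L v => w'.1.adicCompletion L) w))) - 1).rank = 0 ∧ (redMat (ϖ⁻¹ •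 (((((q.out⁻¹ * tp * q.out)).val : GL (Fin 3) (UnitaryGroup.LocalRing L v)).val.map (Pi.evalRingHom (fun w' : PlacesOver L v => w'.1.adicCompletion L) w)) - 1))).rank = 0}.ncard : ℂ) - ({q : (((cmDatum L 3 H').Local v) ⧸ cmLocalIntegralLevel L 3 H' v) | q ∈ MulAction.fixedBy (((cmDatum L 3 H').Local v) ⧸ cmLocalIntegralLevel L 3 H' v) tm ∧ (redMat (((((q.out⁻¹ * tm * q.out)).val : GL (Fin 3) (UnitaryGroup.LocalRing L v)).val.map (Pi.evalRingHom (fun w' : PlacesOver L v => w'.1.adicCompletion L) w))) - 1).rank = 0 ∧ (redMat (ϖ⁻¹ • (((((q.out⁻¹ * tm * q.out)).val : GL (Fin 3) (UnitaryGroup.LocalRing L v)).val.map (Pi.evalRingHom (fun w' : PlacesOver L v => w'.1.adicCompletion L) w)) - 1))).rank = 0}.ncard : ℂ)) = (hilbertSymbol (v.adicCompletion ↥(maximalRealSubfield L)) yl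
        (algebraMap ↥(maximalRealSubfield L) _ ((cmQuadraticGenerator L : 𝓞 ↥(maximalRealSubfield L)) : ↥(maximalRealSubfield L))) : ℂ) * (2 * ((Ideal.absNorm v.asIdeal : ℂ) ^ n - 1) / (((Ideal.absNorm v.asIdeal : ℂ) - 1) * (Ideal.absNorm v.asIdeal : ℂ) ^ 2))) :
    ∃ a : Fin 2 → ℂ,
    -- (J) the LEVI TEST
    ((∑ s, a s * (![(1 : ℂ), ((Ideal.absNorm v.asIdeal : ℂ) + 1) / 2] : Fin 2 → ℂ) s) * (νH.real (((cmLocalIntegralLevel L 2 (Matrix.of fun i j : Fin 2 => if i.val + j.val + 1 = 2 then (1 : L) else 0) v).prod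
                (cmLocalIntegralLevel L 1 (Matrix.of fun i j : Fin 1 => if i.val + j.val + 1 = 1 then (1 : L) else 0) v) : Subgroup _) : Set _) : ℂ) =
      (hilbertSymbol (v.adicCompletion ↥(maximalRealSubfield L)) yl
        (algebraMap ↥(maximalRealSubfield L) _ ((cmQuadraticGenerator L : 𝓞 ↥(maximalRealSubfield L)) : ↥(maximalRealSubfield L))) : ℂ) *
        (νG.real (cmLocalIntegralLevel L 3 H' v : Set ((cmDatum L 3 H').Local v)) : ℂ) * (c₂ * (1 - (Ideal.absNorm v.asIdeal : ℂ)⁻¹) +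
          (Ideal.absNorm v.asIdeal : ℂ)⁻¹ * (c' 2 * (1 - (Ideal.absNorm v.asIdeal : ℂ)⁻¹) + 2⁻¹ * (c₁s + c₁n) * ((Ideal.absNorm v.asIdeal : ℂ)⁻¹ * (1 - (Ideal.absNorm v.asIdeal : ℂ)⁻¹)) +
            c' 0 * ((Ideal.absNorm v.asIdeal : ℂ) ^ 2)⁻¹))) ∧
    -- (T1) the TYPE-(1) row for `(ψ^ram, a)`
    (∃ V ∈ 𝓝 (1 : ((cmDatum L 2 (Matrix.of fun i j : Fin 2 => if i.val + j.val + 1 = 2 then (1 : L) else 0)).Local v × (cmDatum L 1 (Matrix.of fun i j : Fin 1 => if i.val + j.val + 1 = 1 then (1 : L) else 0)).Local v)), ∀ γH ∈ V, IsLocalGRegular L v γH →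
      (∃ x : w.1.adicCompletion L, (((((γH).1.val : GL (Fin 2) (UnitaryGroup.LocalRing L v)).val.map (Pi.evalRingHom (fun w' : PlacesOver L v => w'.1.adicCompletion L) w))).charpoly).IsRoot x) →
      ¬ (∃ (y : ((cmDatum L 2 (Matrix.of fun i j : Fin 2 => if i.val + j.val + 1 = 2 then (1 : L) else 0)).Local v × (cmDatum L 1 (Matrix.of fun i j : Fin 1 => if i.val + j.val + 1 = 1 then (1 : L) else 0)).Local v)) (d' : Fin 2 → (UnitaryGroup.LocalRing L v)ˣ),
          glDiagonal 2 (UnitaryGroup.LocalRing L v) d' = ((y * γH * y⁻¹).1.val : GL (Fin 2) (UnitaryGroup.LocalRing L v))) →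
      ∑ᶠ cG : ConjClasses ((cmDatum L 3 H').Local v),
            ((finExplicitCollection L H' μ (finExplicitDelta_conj_left_all L H' μ) (finExplicitDelta_conj_right_all L H' μ)) v).Δ γH (Quotient.out cG) *
              classOrbitalIntegral mG g cG =
        ∑ s, a s * stableOrbitalIntegralRel (IsLocalStablyConjH L v) mH ((![((((cmLocalIntegralLevel L 2 (Matrix.of fun i j : Fin 2 => if i.val + j.val + 1 = 2 then (1 : L) else 0) v).prod (cmLocalIntegralLevel L 1 (Matrix.of fun i j : Fin 1 => if i.val + j.val + 1 = 1 then (1 : L) else 0) v) : Subgroup _) : Set _).indicator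
              (fun h => if (redMat (((h.1.val : GL (Fin 2) (UnitaryGroup.LocalRing L v)).val.map (Pi.evalRingHom (fun w' : PlacesOver L v => w'.1.adicCompletion L) w))) - 1) ^ 2 = 0 ∧ (redMat (((h.1.val : GL (Fin 2) (UnitaryGroup.LocalRing L v)).val.map (Pi.evalRingHom (fun w' : PlacesOver L v => w'.1.adicCompletion L) w))) - 1).rank = 0 then (1 : ℂ) else 0)),
        (Set.indicator {h : ((cmDatum L 2 (Matrix.of fun i j : Fin 2 => if i.val + j.val + 1 = 2 then (1 : L) else 0)).Local v × (cmDatum L 1 (Matrix.of fun i j : Fin 1 => if i.val + j.val + 1 = 1 then (1 : L) else 0)).Local v) | ∀ a b : Fin 2, Valued.v (ϖ ^ (b : ℕ) * (ϖ ^ (a : ℕ))⁻¹ * (((localNonsplitEquiv (IsCMField.complexConj L) (Matrix.of fun i j : Fin 2 => if i.val + j.val + 1 = 2 then (1 : L) else 0) (IsCMField.complexConj_ne_one L) w hw h.1 : ↥(unitaryGroupOfForm (galAdicCompletionMap (L := L) (IsCMField.complexConj L) hw) (placeForm (Matrix.of fun i j : Fin 2 => if i.val + j.val + 1 = 2 then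 (1 : L) else 0) w.1))) : GL (Fin 2) (w.1.adicCompletion L)) : Matrix (Fin 2) (Fin 2) (w.1.adicCompletion L)) a b) ≤ 1} (fun _ => (1 : ℂ)))] : Fin 2 → ((cmDatum L 2 (Matrix.of fun i j : Fin 2 => if i.val + j.val + 1 = 2 then (1 : L) else 0)).Local v × (cmDatum L 1 (Matrix.of fun i j : Fin 1 => if i.val + j.val + 1 = 1 then (1 : L) else 0)).Local v) → ℂ) s) γH) ∧
    -- (T2) the TYPE-(2) row for `(ψ^ram, a)`
    (∃ V ∈ 𝓝 (1 : ((cmDatum L 2 (Matrix.of fun i j : Fin 2 => if i.val + j.val + 1 = 2 then (1 : L) else 0)).Local v × (cmDatum L 1 (Matrix.of fun i j : Fin 1 => if i.val + j.val + 1 = 1 then (1 : L) else 0)).Local v)), ∀ γH ∈ V, IsLocalGRegular L v γH →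
      ¬ (∃ x : w.1.adicCompletion L, (((((γH).1.val : GL (Fin 2) (UnitaryGroup.LocalRing L v)).val.map (Pi.evalRingHom (fun w' : PlacesOver L v => w'.1.adicCompletion L) w))).charpoly).IsRoot x) →
      ∑ᶠ cG : ConjClasses ((cmDatum L 3 H').Local v),
            ((finExplicitCollection L H' μ (finExplicitDelta_conj_left_all L H' μ) (finExplicitDelta_conj_right_all L H' μ)) v).Δ γH (Quotient.out cG) *
              classOrbitalIntegral mG g cG =
        ∑ s, a s * stableOrbitalIntegralRel (IsLocalStablyConjH L v) mH ((![((((cmLocalIntegralLevel L 2 (Matrix.of fun i j : Fin 2 => if i.val + j.val + 1 = 2 then (1 : L) else 0) v).prod (cmLocalIntegralLevel L 1 (Matrix.of fun i j : Fin 1 => if i.val + j.val + 1 = 1 then (1 : L) else 0) v) : Subgroup _) : Set _).indicator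
              (fun h => if (redMat (((h.1.val : GL (Fin 2) (UnitaryGroup.LocalRing L v)).val.map (Pi.evalRingHom (fun w' : PlacesOver L v => w'.1.adicCompletion L) w))) - 1) ^ 2 = 0 ∧ (redMat (((h.1.val : GL (Fin 2) (UnitaryGroup.LocalRing L v)).val.map (Pi.evalRingHom (fun w' : PlacesOver L v => w'.1.adicCompletion L) w))) - 1).rank = 0 then (1 : ℂ) else 0)),
        (Set.indicator {h : ((cmDatum L 2 (Matrix.of fun i j : Fin 2 => if i.val + j.val + 1 = 2 then (1 : L) else 0)).Local v × (cmDatum L 1 (Matrix.of fun i j : Fin 1 => if i.val + j.val + 1 = 1 then (1 : L) else 0)).Local v) | ∀ a b : Fin 2, Valued.v (ϖ ^ (b : ℕ) * (ϖ ^ (a : ℕ))⁻¹ * (((localNonsplitEquiv (IsCMField.complexConj L) (Matrix.of fun i j : Fin 2 => if i.val + j.val + 1 = 2 then (1 : L) else 0) (IsCMField.complexConj_ne_one L) w hw h.1 : ↥(unitaryGroupOfForm (galAdicCompletionMap (L := L) (IsCMField.complexConj L) hw) (placeForm (Matrix.of fun i j : Fin 2 => if i.val + j.val + 1 = 2 then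 (1 : L) else 0) w.1))) : GL (Fin 2) (w.1.adicCompletion L)) : Matrix (Fin 2) (Fin 2) (w.1.adicCompletion L)) a b) ≤ 1} (fun _ => (1 : ℂ)))] : Fin 2 → ((cmDatum L 2 (Matrix.of fun i j : Fin 2 => if i.val + j.val + 1 = 2 then (1 : L) else 0)).Local v × (cmDatum L 1 (Matrix.of fun i j : Fin 1 => if i.val + j.val + 1 = 1 then (1 : L) else 0)).Local v) → ℂ) s) γH) := by
  have hq : Ideal.absNorm v.asIdeal ≠ 0 := by rw [Ne, Ideal.absNorm_eq_zero_iff]; exact v.ne_bot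
  have hKH : (νH.real (((cmLocalIntegralLevel L 2 (Matrix.of fun i j : Fin 2 => if i.val + j.val + 1 = 2 then (1 : L) else 0) v).prod
                (cmLocalIntegralLevel L 1 (Matrix.of fun i j : Fin 1 => if i.val + j.val + 1 = 1 then (1 : L) else 0) v) : Subgroup _) : Set _) : ℂ) ≠ 0 := by
    have hco := isCompact_isOpen_cmLocalIntegralLevel_prod L 2 1 (Matrix.of fun i j : Fin 2 => if i.val + j.val + 1 = 2 then (1 : L) else 0)
      (Matrix.of fun i j : Fin 1 => if i.val + j.val + 1 = 1 then (1 : L) else 0) v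
    have hpos := hco.2.measure_pos νH ⟨1, Subgroup.one_mem _⟩
    have hfin := hco.1.measure_lt_top (μ := νH)
    exact_mod_cast (ENNReal.toReal_pos hpos.ne' hfin.ne).ne'
  exact ⟨(![((hilbertSymbol (v.adicCompletion ↥(maximalRealSubfield L)) yl
        (algebraMap ↥(maximalRealSubfield L) _ ((cmQuadraticGenerator L : 𝓞 ↥(maximalRealSubfield L)) : ↥(maximalRealSubfield L))) : ℂ) *
          (νG.real (cmLocalIntegralLevel L 3 H' v : Set ((cmDatum L 3 H').Local v)) : ℂ) / (νH.real (((cmLocalIntegralLevel L 2 (Matrix.of fun i j : Fin 2 => if i.val + j.val + 1 = 2 then (1 : L) else 0) v).prod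
                (cmLocalIntegralLevel L 1 (Matrix.of fun i j : Fin 1 => if i.val + j.val + 1 = 1 then (1 : L) else 0) v) : Subgroup _) : Set _) : ℂ)) * (c₂ * (-2 / (Ideal.absNorm v.asIdeal : ℂ)) + c' 2 * (-2 / (Ideal.absNorm v.asIdeal : ℂ) ^ 2) + c₁s * (((Ideal.absNorm v.asIdeal : ℂ) ^ 2 + (Ideal.absNorm v.asIdeal : ℂ) - 1) / (Ideal.absNorm v.asIdeal : ℂ) ^ 3) + c₁n * (((Ideal.absNorm v.asIdeal : ℂ) ^ 2 + (Ideal.absNorm v.asIdeal : ℂ) - 1) / (Ideal.absNorm v.asIdeal : ℂ) ^ 3) +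
          c' 0 * (2 / (Ideal.absNorm v.asIdeal : ℂ) ^ 3)),
        (2 / ((Ideal.absNorm v.asIdeal : ℂ) + 1) * ((hilbertSymbol (v.adicCompletion ↥(maximalRealSubfield L)) yl
        (algebraMap ↥(maximalRealSubfield L) _ ((cmQuadraticGenerator L : 𝓞 ↥(maximalRealSubfield L)) : ↥(maximalRealSubfield L))) : ℂ) *
          (νG.real (cmLocalIntegralLevel L 3 H' v : Set ((cmDatum L 3 H').Local v)) : ℂ) / (νH.real (((cmLocalIntegralLevel L 2 (Matrix.of fun i j : Fin 2 => if i.val + j.val + 1 = 2 then (1 : L) else 0) v).prod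
                (cmLocalIntegralLevel L 1 (Matrix.of fun i j : Fin 1 => if i.val + j.val + 1 = 1 then (1 : L) else 0) v) : Subgroup _) : Set _) : ℂ))) * (c₂ * (((Ideal.absNorm v.asIdeal : ℂ) + 1) / (Ideal.absNorm v.asIdeal : ℂ)) + c' 2 * (((Ideal.absNorm v.asIdeal : ℂ) + 1) / (Ideal.absNorm v.asIdeal : ℂ) ^ 2) + c₁s * (-(((Ideal.absNorm v.asIdeal : ℂ) + 1) * (2 * (Ideal.absNorm v.asIdeal : ℂ) - 1)) / (2 * (Ideal.absNorm v.asIdeal : ℂ) ^ 3)) +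
          c₁n * (-(((Ideal.absNorm v.asIdeal : ℂ) + 1) * (2 * (Ideal.absNorm v.asIdeal : ℂ) - 1)) / (2 * (Ideal.absNorm v.asIdeal : ℂ) ^ 3)) + c' 0 * (-1 / (Ideal.absNorm v.asIdeal : ℂ) ^ 3))] : Fin 2 → ℂ),
    leviTest_of_transferMatrix hq _ _ _ hKH c₂ (c' 2) c₁s c₁n (c' 0),
    typeOneRow_ram L H' μ hH' w hw he hH'w hH'i hμu hμω h2 ϖ hϖ hσϖ A hA hframe νH νG hmH hmG g hg hgK hginv hg1
    c₂ c' hc hc' c₁s c₁n hR4s hR4n yl hyl,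
    typeTwoRow_ram_of_counts L H' μ hH' w hw he hH'w hH'i hμu hμω h2 ϖ hϖ hσϖ A hA hframe νH νG hmH hmG g hg hgK hginv hg1
    c₂ c' hc hc' c₁s c₁n hR4s hR4n yl hyl hCe hCo⟩

end Literature.NumberTheory.Rogawski1990

end
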